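import Literature.IUT.HodgeArakelov.AbsTopMonoidsIsmLogShellProofs

/-!
# [IUTchII] §1, Example 1.8 (ix) at the GENUINE model: `I(G)` is the multiplicative log-shell, and
# `log_k̄` carries it onto `p⁻¹ · log_k̄(𝒪_k^×) ⊆ k` — PROOFS

Proof-only sequel (abc-iut cell, block C / wave W6 cone prover abc-iut-w6-d013; node **IUTchII:Ex1.8(ix)**) of
`AbsTopInterfacesLogShellProofs.lean` (p427938) / `AbsTopMonoidsIsmLogShellProofs.lean` (p428542), over
abc-iut-L6-t13's / abc-iut-L6-d2's GENUINE producers `AbsTopMonoids.genuineOfModel` (p421397) /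
`AbsTopMonoids.genuineOfModelIsm` (p427597: `O^⊳(G) = 𝒪_k̄^⊳` for an MLF `k` with algebraic closure `k̄`, `G`
acting through a chosen identification `theta : G ⥲ Gal(k̄/k)`), and abc-iut-L6-d2's [AbsTopIII] Def. 3.1
vocabulary (`GaloisPadicLogPerfection.lean` p411091: `unitGroup`, `invariantUnitClasses`, `multLogShell`, the
carrier change `toAdd_logEquiv_image_multLogShell`; `GaloisPadicLogMLF.lean`: the real logarithm
`MLFClosure.galoisPadicLog`, `MLFClosure.logEquiv : k~ = 𝒪_k̄^×⧸𝒪_k̄^μ ⥲ k̄`; `GaloisPadicLogShellBridge.lean`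
p411328: `MLFClosure.coe_preLogShell_subset_range_algebraMap`).  NO new definitions.

Source: S. Mochizuki, *Inter-universal Teichmüller theory II*, §1, Example 1.8 (ix), kurims manuscript (Dec. 2020)
p. 41: "one may also construct the log-shell `I(G) ⊆ O^{×μ}(G)` [i.e., `p⁻¹` times the image of the
`G`-invariants of `O^×(G)` in `O^{×μ}(G)` — cf. [AbsTopIII], Proposition 5.8, (ii)]" (claim key `Mochizuki2012`,
status DISPUTED, D-0012; record-only); [AbsTopIII] Def. 3.1 (iv) p. 69 (the pre-log-shell "determined by the
image of the subgroup `𝒪_k^× = (𝒪_k̄^×)^{Π_k}` of Galois-invariants of `𝒪_k̄^×`"), Def. 5.4 (iii) / Prop. 5.8 (ii)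
(the log-shell `ℐ_k ⊆ k`).

What is PROVED — the bracket "cf. [AbsTopIII], Proposition 5.8, (ii)" of Ex. 1.8 (ix) AT THE GENUINE MODEL:
* `mem_unitsInvariants_genuineOfModel_iff`: at the genuine producer, `x ∈ O^×(G)^G` iff its image under
  abc-iut-L6-d2's units bridge `(𝒪_k̄^⊳)ˣ ⥲ 𝒪_k̄^×` is fixed by every `σ ∈ Gal(k̄/k)` (the identification `theta`
  is bijective; `unitGroupGaloisMap_eq_self_iff`: iff the underlying element of `k̄` is fixed); hence the
  invariants `O^×(G)^G` go onto the `G_k`-invariant units (`coe_unitsBridge_mem_invariantUnits_iff`,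
  `unitsBridge_image_unitsInvariants`) and, modulo torsion, the lattice `Im(O^×(G)^G)` onto
  `invariantUnitClasses` (`oxmuBridge_image_lattice`);
* **`oxmuBridge_image_logShell`**: the interface log-shell `I(G)` of the genuine producer is carried by
  `oxmuBridge : O^{×μ}(G) ⥲ k~` ONTO abc-iut-L6-d2's multiplicative log-shell `multLogShell k k̄ p`
  (exponent `p = S.p` of the setting);
* **`log_image_logShell`**: composing with `log_k̄ : k~ ⥲ k̄`, `I(G)` goes ONTO `p⁻¹ · log_k̄(𝒪_k^×)`, hence
  into `p⁻¹ ·` (pre-log-shell) (`log_image_logShell_subset_smul_preLogShell`) and into `k ⊆ k̄`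
  (`log_image_logShell_subset_range_algebraMap`) — "`p⁻¹` times the image of the `G`-invariants", now as an
  identity of subsets of `k̄` at the model;
* the same for the producer with genuine isometries `genuineOfModelIsm` (same log-shell, p428542).
Honest scope: the factor is print's `p⁻¹` ([IUTchII]); [AbsTopIII] Def. 5.4 (iii) uses `(p*)⁻¹` (`p* = p` for odd
`p`, which `ThetaSetting.p_odd` guarantees here) — the comparison with abc-iut-L4-t3's additive `logShell` is
abc-iut-L6-d2's `GaloisPadicLogShellBridge.lean`, cited BY NAME, not restated.
-/

set_option autoImplicit false

noncomputable section

namespace Literature.IUT.HodgeArakelov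

namespace AbsTopMonoids

open CategoryTheory
open Literature.AnabelianGeometry.AbsoluteAnabelian Genuine
open scoped Pointwise

section Producer

variable (S : ThetaSetting.{0}) (C : MLFClosure.{0}) (ε : S.Gk ≃ₜ* (ModelMLFGaloisData.galois C.k C.K).tmPair.Pi)
  (hΔ : ∀ f : S.PiX ≃ₜ* S.PiX, S.DeltaX.map f.toMulEquiv.toMonoidHom = S.DeltaX)
  (hq : Nonempty (TopGroup.quot S.PiX S.DeltaX ≃ₜ* S.Gk))

/-! ### The `G`-invariants of `O^×(G) = (𝒪_k̄^⊳)ˣ` at the genuine producer -/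

/-- **`O^×(G)^G` at the genuine model = the Galois-fixed units**: under abc-iut-L6-d2's units bridge
`(𝒪_k̄^⊳)ˣ ⥲ 𝒪_k̄^×`, `x ∈ O^×(G)^G` iff `unitsBridge x` is fixed by every `σ ∈ Gal(k̄/k)` (the action of `G` is the
Galois action through the bijective identification `theta : G ⥲ Gal(k̄/k)`, `unitsBridge_unitsActionOf`) —
[AbsTopIII] Def. 3.1 (iv) "`𝒪_k^× = (𝒪_k̄^×)^{Π_k}`". [claim: Mochizuki2012, status: disputed] (IUTchII §1 Ex 1.8 (ix), kurims p.41) -/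
theorem mem_unitsInvariants_genuineOfModel_iff (G : IsoClass S.Gk) (x : (nonzeroIntegers C.k C.K)ˣ) :
    x ∈ (genuineOfModel S C ε hΔ hq).unitsInvariants G ↔
      ∀ σ : C.K ≃ₐ[C.k] C.K, unitGroupGaloisMap σ (unitsBridge C x) = unitsBridge C x := by
  change (∀ g : G.G, unitsActionOf C (theta C ε G).toMonoidHom g x = x) ↔ _
  constructor
  · intro h σ
    obtain ⟨g, rfl⟩ : ∃ g : G.G, theta C ε G g = σ := ⟨(theta C ε G).symm σ, (theta C ε G).apply_symm_apply σ⟩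
    have h1 := congrArg (unitsBridge C) (h g)
    rw [unitsBridge_unitsActionOf] at h1
    exact h1
  · intro h g
    apply (unitsBridge C).injective
    rw [unitsBridge_unitsActionOf]
    exact h _

/-- A unit `u ∈ 𝒪_k̄^×` is fixed by `σ` iff its underlying element of `k̄` is.
[cite: MochizukiAbsTopIII2015, Definition 3.1 (iv) p.69] -/
theorem unitGroupGaloisMap_eq_self_iff (σ : C.K ≃ₐ[C.k] C.K) (u : unitGroup C.k C.K) :
    unitGroupGaloisMap σ u = u ↔ σ ((u : (C.K)ˣ) : C.K) = ((u : (C.K)ˣ) : C.K) := by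
  rw [← unitGroupGaloisMap_coe σ u]
  exact ⟨fun h => by rw [h], fun h => Subtype.ext (Units.ext h)⟩

/-- Under the units bridge, membership in `O^×(G)^G` is membership of the underlying element of `k̄` in the
`G_k`-invariant units `invariantUnits k k̄` of [AbsTopIII] Def. 3.1 (iv).
[claim: Mochizuki2012, status: disputed] (IUTchII §1 Ex 1.8 (ix), kurims p.41) -/
theorem coe_unitsBridge_mem_invariantUnits_iff (G : IsoClass S.Gk) (x : (nonzeroIntegers C.k C.K)ˣ) :
    (((unitsBridge C x : unitGroup C.k C.K) : (C.K)ˣ) : C.K) ∈ invariantUnits C.k C.K ↔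
      x ∈ (genuineOfModel S C ε hΔ hq).unitsInvariants G := by
  have hx : (((unitsBridge C x : unitGroup C.k C.K) : (C.K)ˣ) : C.K) ∈ unitSubmonoid C.k C.K :=
    (unitsBridge C x).2
  refine Iff.trans ?_ (mem_unitsInvariants_genuineOfModel_iff S C ε hΔ hq G x).symm
  simp only [invariantUnits, Set.mem_setOf_eq, AlgEquiv.smul_def, unitGroupGaloisMap_eq_self_iff]
  exact ⟨fun h => h.2, fun h => ⟨hx, h⟩⟩

/-- **The invariants go onto the `G_k`-invariant units** under the units bridge.
[claim: Mochizuki2012, status: disputed] (IUTchII §1 Ex 1.8 (ix), kurims p.41) -/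
theorem unitsBridge_image_unitsInvariants (G : IsoClass S.Gk) :
    unitsBridge C '' (genuineOfModel S C ε hΔ hq).unitsInvariants G =
      {u : unitGroup C.k C.K | ((u : (C.K)ˣ) : C.K) ∈ invariantUnits C.k C.K} := by
  ext u
  constructor
  · rintro ⟨x, hx, rfl⟩
    exact (coe_unitsBridge_mem_invariantUnits_iff S C ε hΔ hq G x).2 hx
  · intro hu
    refine ⟨(unitsBridge C).symm u, ?_, MulEquiv.apply_symm_apply _ _⟩
    refine (coe_unitsBridge_mem_invariantUnits_iff S C ε hΔ hq G _).1 ?_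
    rw [MulEquiv.apply_symm_apply]
    exact hu

/-- **The lattice `Im(O^×(G)^G) ⊆ O^{×μ}(G)` goes onto `invariantUnitClasses`** (the classes of `𝒪_k^×` in
`k~ = 𝒪_k̄^× ⧸ 𝒪_k̄^μ`) under the bridge `oxmuBridge : O^{×μ}(G) ⥲ k~`.
[claim: Mochizuki2012, status: disputed] (IUTchII §1 Ex 1.8 (ix), kurims p.41) -/
theorem oxmuBridge_image_lattice (G : IsoClass S.Gk) :
    oxmuBridge C '' ((QuotientGroup.mk : (nonzeroIntegers C.k C.K)ˣ → ModTorsion (nonzeroIntegers C.k C.K)ˣ) ''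
        (genuineOfModel S C ε hΔ hq).unitsInvariants G) =
      invariantUnitClasses C.k C.K := by
  ext z
  constructor
  · rintro ⟨y, ⟨x, hx, rfl⟩, rfl⟩
    exact ⟨unitsBridge C x, (coe_unitsBridge_mem_invariantUnits_iff S C ε hΔ hq G x).2 hx,
      (oxmuBridge_mk C x).symm⟩
  · rintro ⟨u, hu, rfl⟩
    refine ⟨QuotientGroup.mk ((unitsBridge C).symm u), ⟨(unitsBridge C).symm u, ?_, rfl⟩, ?_⟩
    · refine (coe_unitsBridge_mem_invariantUnits_iff S C ε hΔ hq G _).1 ?_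
      rw [MulEquiv.apply_symm_apply]
      exact hu
    · rw [oxmuBridge_mk, MulEquiv.apply_symm_apply]

/-! ### The log-shell at the genuine producer -/

/-- Membership form: `oxmuBridge y` lies in abc-iut-L6-d2's multiplicative log-shell (exponent `p`) iff `y ∈ I(G)`.
[claim: Mochizuki2012, status: disputed] (IUTchII §1 Ex 1.8 (ix), kurims p.41) -/
theorem oxmuBridge_mem_multLogShell_iff (G : IsoClass S.Gk) (y : ModTorsion (nonzeroIntegers C.k C.K)ˣ) :
    oxmuBridge C y ∈ multLogShell C.k C.K S.p ↔ y ∈ (genuineOfModel S C ε hΔ hq).logShell G := by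
  rw [multLogShell, Set.mem_setOf_eq, ← map_pow, ← oxmuBridge_image_lattice S C ε hΔ hq G,
    (oxmuBridge C).injective.mem_set_image]
  exact Iff.rfl

/-- **`I(G)` at the genuine model IS the multiplicative log-shell**: `oxmuBridge : O^{×μ}(G) ⥲ k~` carries the
interface log-shell `I(G) = p⁻¹ · Im(O^×(G)^G)` ONTO `multLogShell k k̄ p = {z ∈ k~ | z^p ∈ [𝒪_k^×]}`.
[claim: Mochizuki2012, status: disputed] (IUTchII §1 Ex 1.8 (ix), kurims p.41) -/
theorem oxmuBridge_image_logShell (G : IsoClass S.Gk) :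
    oxmuBridge C '' (genuineOfModel S C ε hΔ hq).logShell G = multLogShell C.k C.K S.p := by
  ext z
  constructor
  · rintro ⟨y, hy, rfl⟩
    exact (oxmuBridge_mem_multLogShell_iff S C ε hΔ hq G y).2 hy
  · intro hz
    refine ⟨(oxmuBridge C).symm z, ?_, MulEquiv.apply_symm_apply _ _⟩
    refine (oxmuBridge_mem_multLogShell_iff S C ε hΔ hq G _).1 ?_
    rw [MulEquiv.apply_symm_apply]
    exact hz

/-- **`log_k̄(I(G)) = p⁻¹ · log_k̄(𝒪_k^×)`**: composing the bridge with the real logarithm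
`log_k̄ : k~ ⥲ k̄` of the MLF closure, the genuine log-shell is carried ONTO "`p⁻¹` times the image of the
`G`-invariants" inside `k̄` (abc-iut-L6-d2's carrier change `toAdd_logEquiv_image_multLogShell`).
[claim: Mochizuki2012, status: disputed] (IUTchII §1 Ex 1.8 (ix), kurims p.41) -/
theorem log_image_logShell (G : IsoClass S.Gk) :
    (fun y : ModTorsion (nonzeroIntegers C.k C.K)ˣ => Multiplicative.toAdd (C.logEquiv (oxmuBridge C y))) ''
        (genuineOfModel S C ε hΔ hq).logShell G =
      ((S.p : ℕ) : C.K)⁻¹ • (C.galoisPadicLog.log '' invariantUnits C.k C.K) := by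
  haveI : CharZero C.K := charZero_of_injective_algebraMap (algebraMap C.k C.K).injective
  have h := Set.image_comp (fun z => Multiplicative.toAdd (C.galoisPadicLog.logEquiv z)) (oxmuBridge C)
    ((genuineOfModel S C ε hΔ hq).logShell G)
  rw [oxmuBridge_image_logShell, C.galoisPadicLog.toAdd_logEquiv_image_multLogShell S.p_prime.pos] at h
  exact h

/-- Hence `log_k̄(I(G)) ⊆ p⁻¹ ·` (pre-log-shell of [AbsTopIII] Def. 3.1 (iv)).
[claim: Mochizuki2012, status: disputed] (IUTchII §1 Ex 1.8 (ix), kurims p.41) -/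
theorem log_image_logShell_subset_smul_preLogShell (G : IsoClass S.Gk) :
    (fun y : ModTorsion (nonzeroIntegers C.k C.K)ˣ => Multiplicative.toAdd (C.logEquiv (oxmuBridge C y))) ''
        (genuineOfModel S C ε hΔ hq).logShell G ⊆
      ((S.p : ℕ) : C.K)⁻¹ • (C.galoisPadicLog.preLogShell : Set C.K) := by
  rw [log_image_logShell]
  exact Set.smul_set_mono AddSubgroup.subset_closure

/-- **`log_k̄(I(G)) ⊆ k`**: the genuine log-shell lands in (the image of) the base field `k ⊆ k̄` — the
log-shell is an invariant of `G_k`, [AbsTopIII] Prop. 5.8 (ii) "`ℐ_k ⊆ k`" (Galois descent, abc-iut-L6-d2's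
`coe_preLogShell_subset_range_algebraMap`). [claim: Mochizuki2012, status: disputed] (IUTchII §1 Ex 1.8 (ix), kurims p.41) -/
theorem log_image_logShell_subset_range_algebraMap (G : IsoClass S.Gk) :
    (fun y : ModTorsion (nonzeroIntegers C.k C.K)ˣ => Multiplicative.toAdd (C.logEquiv (oxmuBridge C y))) ''
        (genuineOfModel S C ε hΔ hq).logShell G ⊆
      Set.range (algebraMap C.k C.K) := by
  refine (log_image_logShell_subset_smul_preLogShell S C ε hΔ hq G).trans ?_
  rintro _ ⟨y, hy, rfl⟩
  obtain ⟨a, ha⟩ := C.coe_preLogShell_subset_range_algebraMap hy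
  refine ⟨((S.p : ℕ) : C.k)⁻¹ * a, ?_⟩
  simp only [map_mul, map_inv₀, map_natCast, ha, smul_eq_mul]

/-! ### The same for the producer with genuine isometries `genuineOfModelIsm` (same log-shell) -/

/-- `I(G)` of `genuineOfModelIsm` goes ONTO the multiplicative log-shell under `oxmuBridge`.
[claim: Mochizuki2012, status: disputed] (IUTchII §1 Ex 1.8 (ix), kurims p.41) -/
theorem oxmuBridge_image_logShell_genuineOfModelIsm (G : IsoClass S.Gk) :
    oxmuBridge C '' (genuineOfModelIsm S C ε hΔ hq).logShell G = multLogShell C.k C.K S.p :=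
  oxmuBridge_image_logShell S C ε hΔ hq G

/-- `log_k̄(I(G)) = p⁻¹ · log_k̄(𝒪_k^×)` for `genuineOfModelIsm`.
[claim: Mochizuki2012, status: disputed] (IUTchII §1 Ex 1.8 (ix), kurims p.41) -/
theorem log_image_logShell_genuineOfModelIsm (G : IsoClass S.Gk) :
    (fun y : ModTorsion (nonzeroIntegers C.k C.K)ˣ => Multiplicative.toAdd (C.logEquiv (oxmuBridge C y))) ''
        (genuineOfModelIsm S C ε hΔ hq).logShell G =
      ((S.p : ℕ) : C.K)⁻¹ • (C.galoisPadicLog.log '' invariantUnits C.k C.K) :=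
  log_image_logShell S C ε hΔ hq G

/-- `log_k̄(I(G)) ⊆ k` for `genuineOfModelIsm`. [claim: Mochizuki2012, status: disputed] (IUTchII §1 Ex 1.8 (ix), kurims p.41) -/
theorem log_image_logShell_genuineOfModelIsm_subset_range_algebraMap (G : IsoClass S.Gk) :
    (fun y : ModTorsion (nonzeroIntegers C.k C.K)ˣ => Multiplicative.toAdd (C.logEquiv (oxmuBridge C y))) ''
        (genuineOfModelIsm S C ε hΔ hq).logShell G ⊆
      Set.range (algebraMap C.k C.K) :=
  log_image_logShell_subset_range_algebraMap S C ε hΔ hq G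

end Producer

end AbsTopMonoids

end Literature.IUT.HodgeArakelov

end
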